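import Summits.CriticalPhenomena.PercolationContinuityZ3.Theorems.SahiMasterFamilyThreePartitionTypedSliceAtoms
import HarnessLib

/-!
# The TYPED SLICE, IV: certificates as data and their soundness (unit `prim-master-conj`, gen 34;
# `--supports stmt-CriticalPhenomena-4575`)

A type-space certificate for a class step of twisted three-partition positivity (memo
`run/shared/lean/prim/prim-l12/prim-master-conj/POINTWISE.md` §34–35) is: a profile bit `β = [e ∈ τ]`, a positive integer scale
`d`, a list `L` of weighted THEOREM atoms (`Atom`: Kleitman with optional spectator type, Theorem A, CONJ-V-nested — each with its
masks; side conditions `Atom.ok`) and a list `I` of weighted IH atoms (threshold triples whose twisted functional is ASSUMED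
nonnegative — the "needs" of the step).  `threePartNT_nonneg_of_cert`: if `certOK L`, the checker of `…TypedSliceKernel` accepts the
residual `d·κ_β − Σ L − Σ I` on a class `cls` containing every realised type, and the IH triples are nonnegative, then
`threePartNT τ 𝒰 𝒱 𝒲 ≥ 0`.  Used by `…ThreePartitionCommonCoreCyclic`, `…ThreePartitionOneMeetZeroEqual`.
No `sorry`, standard axioms.  HONEST LABEL: a framework — it proves nothing about the crux by itself. [this work]
-/

noncomputable section

open Finset
open scoped symmDiff Classical

namespace Summit.CriticalPhenomena.PercolationContinuityZ3.Theorems.ThreePartition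

namespace TypedSlice

variable {ι : Type*}

section Cert

variable [Fintype ι] (𝒰 𝒱 𝒲 : Set (Set ι)) (e : ι) (τ : Set ι)

/-! ## Certificates as data -/

/-- A THEOREM atom of the bank (Kleitman with optional spectator type / Theorem A / CONJ-V-nested), by its masks. [this work] -/
inductive Atom : Type
  | kl (s : Option Ty) (Y Z : ℕ)
  | ta (G H S Y : ℕ)
  | cv (V W Y : ℕ)

/-- The integrand of an atom. [this work] -/
def Atom.eval : Atom → Ty → Ty → Ty → ℤ
  | .kl none Y Z => atomKLm anyT Y Z
  | .kl (some s) Y Z => atomKLm (isT s) Y Z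
  | .ta G H S Y => atomTA G H S Y
  | .cv V W Y => atomCV V W Y

/-- The side conditions of an atom (monotone masks; nested pair for CONJ-V). [this work] -/
def Atom.ok : Atom → Bool
  | .kl _ Y Z => monoM Y && monoM Z
  | .ta G H _ Y => monoM G && (monoM H && monoP Y)
  | .cv V W Y => monoM V && (monoM W && (monoP Y && (subM V W || subM W V)))

/-- **Every well-formed atom has a nonnegative pinned sum.** [this work] -/
theorem Atom.tsumP_nonneg (h𝒰 : IsUpperSet 𝒰) (h𝒱 : IsUpperSet 𝒱) (h𝒲 : IsUpperSet 𝒲) :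
    ∀ a : Atom, a.ok = true → 0 ≤ tsumP 𝒰 𝒱 𝒲 e τ a.eval
  | .kl none Y Z, h => by
    simp only [Atom.ok, Bool.and_eq_true] at h
    exact tsumP_atomKLm_nonneg 𝒰 𝒱 𝒲 e τ h𝒰 h𝒱 h𝒲 anyT h.1 h.2
  | .kl (some s) Y Z, h => by
    simp only [Atom.ok, Bool.and_eq_true] at h
    exact tsumP_atomKLm_nonneg 𝒰 𝒱 𝒲 e τ h𝒰 h𝒱 h𝒲 (isT s) h.1 h.2
  | .ta G H S Y, h => by
    simp only [Atom.ok, Bool.and_eq_true] at h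
    exact tsumP_atomTA_nonneg 𝒰 𝒱 𝒲 e τ h𝒰 h𝒱 h𝒲 S h.1 h.2.1 h.2.2
  | .cv V W Y, h => by
    simp only [Atom.ok, Bool.and_eq_true] at h
    exact tsumP_atomCV_nonneg 𝒰 𝒱 𝒲 e τ h𝒰 h𝒱 h𝒲 h.1 h.2.1 h.2.2.1 h.2.2.2

/-- The weighted sum of a list of atoms. [this work] -/
def certSum (L : List (ℕ × Atom)) : Ty → Ty → Ty → ℤ :=
  fun ta tb tc => (L.map fun p => (p.1 : ℤ) * p.2.eval ta tb tc).sum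

/-- All atoms of a list are well formed. [this work] -/
def certOK (L : List (ℕ × Atom)) : Bool := L.all fun p => p.2.ok

/-- **A well-formed weighted atom list has a nonnegative pinned sum.** [this work] -/
theorem tsumP_certSum_nonneg (h𝒰 : IsUpperSet 𝒰) (h𝒱 : IsUpperSet 𝒱) (h𝒲 : IsUpperSet 𝒲) {L : List (ℕ × Atom)}
    (hL : certOK L = true) : 0 ≤ tsumP 𝒰 𝒱 𝒲 e τ (certSum L) := by
  unfold certOK at hL
  induction L with
  | nil => simp [certSum, tsumP]
  | cons p L ih =>
    simp only [List.all_cons, Bool.and_eq_true] at hL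
    have h1 : 0 ≤ tsumP 𝒰 𝒱 𝒲 e τ p.2.eval := Atom.tsumP_nonneg 𝒰 𝒱 𝒲 e τ h𝒰 h𝒱 h𝒲 p.2 hL.1
    have h2 := ih hL.2
    have hsplit : tsumP 𝒰 𝒱 𝒲 e τ (certSum (p :: L))
        = (p.1 : ℤ) * tsumP 𝒰 𝒱 𝒲 e τ p.2.eval + tsumP 𝒰 𝒱 𝒲 e τ (certSum L) := by
      rw [← tsumP_const_mul, ← tsumP_add]
      exact tsumP_congr 𝒰 𝒱 𝒲 e τ fun a b c => by simp [certSum]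
    rw [hsplit]
    exact add_nonneg (mul_nonneg (by exact_mod_cast Nat.zero_le _) h1) h2

/-- The weighted sum of a list of IH atoms (three-partition patterns of threshold triples). [this work] -/
def ihSum (I : List (ℕ × Ty × Ty × Ty)) : Ty → Ty → Ty → ℤ :=
  fun ta tb tc => (I.map fun p => (p.1 : ℤ) * atomNt p.2.1 p.2.2.1 p.2.2.2 ta tb tc).sum

/-- A weighted IH list has a nonnegative pinned sum when every listed triple has. [this work] -/
theorem tsumP_ihSum_nonneg {I : List (ℕ × Ty × Ty × Ty)}
    (hI : ∀ p ∈ I, 0 ≤ tsumP 𝒰 𝒱 𝒲 e τ (atomNt p.2.1 p.2.2.1 p.2.2.2)) : 0 ≤ tsumP 𝒰 𝒱 𝒲 e τ (ihSum I) := by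
  induction I with
  | nil => simp [ihSum, tsumP]
  | cons p I ih =>
    have h1 := hI p (by simp)
    have h2 := ih fun q hq => hI q (by simp [hq])
    have hsplit : tsumP 𝒰 𝒱 𝒲 e τ (ihSum (p :: I))
        = (p.1 : ℤ) * tsumP 𝒰 𝒱 𝒲 e τ (atomNt p.2.1 p.2.2.1 p.2.2.2) + tsumP 𝒰 𝒱 𝒲 e τ (ihSum I) := by
      rw [← tsumP_const_mul, ← tsumP_add]
      exact tsumP_congr 𝒰 𝒱 𝒲 e τ fun a b c => by simp [ihSum]
    rw [hsplit]
    exact add_nonneg (mul_nonneg (by exact_mod_cast Nat.zero_le _) h1) h2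

/-- The residual of a certificate: `d·κ_β − Σ λ·atoms − Σ μ·IH`. [this work] -/
def certResid (β : Bool) (d : ℕ) (L : List (ℕ × Atom)) (I : List (ℕ × Ty × Ty × Ty)) : Ty → Ty → Ty → ℤ :=
  fun ta tb tc => (d : ℤ) * kappa β ta tb tc - certSum L ta tb tc - ihSum I ta tb tc

/-- **SOUNDNESS OF TYPE-SPACE CERTIFICATES.**  If the atoms are well formed, the checker accepts the residual on the class `cls`,
every realised type is in `cls`, and every IH triple has a nonnegative pinned sum, then `d · threePartNT τ 𝒰 𝒱 𝒲 ≥ 0`'s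
pinned form holds: `0 ≤ tsumP (kappa β)` (for `d ≥ 1`). [this work] -/
theorem tsumP_kappa_nonneg_of_cert (h𝒰 : IsUpperSet 𝒰) (h𝒱 : IsUpperSet 𝒱) (h𝒲 : IsUpperSet 𝒲) {β : Bool} {d : ℕ}
    (hd : 1 ≤ d) {L : List (ℕ × Atom)} {I : List (ℕ × Ty × Ty × Ty)} {cls : Ty → Bool} (hL : certOK L = true)
    (hchk : check cls (certResid β d L I) = true) (hcls : ∀ w : Set ι, cls (typ 𝒰 𝒱 𝒲 e w) = true)
    (hI : ∀ p ∈ I, 0 ≤ tsumP 𝒰 𝒱 𝒲 e τ (atomNt p.2.1 p.2.2.1 p.2.2.2)) :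
    0 ≤ tsumP 𝒰 𝒱 𝒲 e τ (kappa β) := by
  have hres : 0 ≤ tsumP 𝒰 𝒱 𝒲 e τ (certResid β d L I) := tsumP_nonneg_of_check 𝒰 𝒱 𝒲 e τ hchk hcls
  have hat := tsumP_certSum_nonneg 𝒰 𝒱 𝒲 e τ h𝒰 h𝒱 h𝒲 hL
  have hih := tsumP_ihSum_nonneg 𝒰 𝒱 𝒲 e τ hI
  have hdec : tsumP 𝒰 𝒱 𝒲 e τ (certResid β d L I)
      = (d : ℤ) * tsumP 𝒰 𝒱 𝒲 e τ (kappa β) - tsumP 𝒰 𝒱 𝒲 e τ (certSum L) - tsumP 𝒰 𝒱 𝒲 e τ (ihSum I) := by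
    rw [← tsumP_const_mul, ← tsumP_sub, ← tsumP_sub]
    exact tsumP_congr 𝒰 𝒱 𝒲 e τ fun a b c => by simp only [certResid]
  have hd' : (0 : ℤ) < d := by exact_mod_cast hd
  nlinarith


/-- **From a checked certificate to three-partition positivity at `(𝒰,𝒱,𝒲;τ)`.** [this work] -/
theorem threePartNT_nonneg_of_cert (h𝒰 : IsUpperSet 𝒰) (h𝒱 : IsUpperSet 𝒱) (h𝒲 : IsUpperSet 𝒲) {d : ℕ} (hd : 1 ≤ d)
    {L : List (ℕ × Atom)} {I : List (ℕ × Ty × Ty × Ty)} {cls : Ty → Bool} (hL : certOK L = true)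
    (hchk : check cls (certResid (decide (e ∈ τ)) d L I) = true) (hcls : ∀ w : Set ι, cls (typ 𝒰 𝒱 𝒲 e w) = true)
    (hI : ∀ p ∈ I, 0 ≤ threePartNT τ (thrSet 𝒰 𝒱 𝒲 e p.2.1) (thrSet 𝒰 𝒱 𝒲 e p.2.2.1) (thrSet 𝒰 𝒱 𝒲 e p.2.2.2)) :
    0 ≤ threePartNT τ 𝒰 𝒱 𝒲 := by
  rw [threePartNT_eq_tsumP_kappa 𝒰 𝒱 𝒲 e τ h𝒰 h𝒱 h𝒲]
  exact tsumP_kappa_nonneg_of_cert 𝒰 𝒱 𝒲 e τ h𝒰 h𝒱 h𝒲 hd hL hchk hcls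
    fun p hp => tsumP_atomNt_nonneg_of 𝒰 𝒱 𝒲 e τ _ _ _ (hI p hp)

end Cert

end TypedSlice

end Summit.CriticalPhenomena.PercolationContinuityZ3.Theorems.ThreePartition
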